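import Mathlib
import Literature.Analysis.FluidPDE.TypeIAncientMild
import Literature.Analysis.FluidPDE.TypeIAncientMildRescale
import Literature.Analysis.FluidPDE.LocalPressureLiouvilleKernel
import Literature.Analysis.UnboundedOperators.HeatKernelBoundedData
import Literature.Analysis.UnboundedOperators.HeatFlowCalculus
import Literature.Analysis.UnboundedOperators.HeatKernelHeatEquation
import Summits.NavierStokesRegularity.NavierStokesRegularity.Theorems.SymmetryModuliCountFarPastLedger
import Summits.NavierStokesRegularity.NavierStokesRegularity.Theorems.SymmetryModuliCountSymmetricLiouvilleSmallAtMinusInfinity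
import Summits.NavierStokesRegularity.NavierStokesRegularity.Theorems.DssFarFieldSlavingBlowupTypeIDssProfileSimilarityEnstrophyTimeOnlyThreshold
import Summits.NavierStokesRegularity.NavierStokesRegularity.Theorems.SqueezeCycleExtremalElementExistsRegularity
import HarnessLib

/-!
# Census block A2 (amplitude meters), cells A2ml (coarse Morrey law) / A2cd / A2cdb / A2lap / A2lapb (DECIDED), A2lapU / A2cdU (OPEN) — instrument «DIFFUSION METER»,
# LINE «diffusion-meter» port, part 1/2: the far-past ledger at unit radius in `lintegral` form (§A), the unit-scale Gaussian average of a uniformly-locally-`L²` field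
# (§B), the coarse law `√s ‖e^{sΔ}u(t)‖_∞ ≤ L(C)` (§C)

Re-homed for the scenario census (typer seat ns-census-typer-1 g8; cells of ns-idea-2 g15 LINE «diffusion-meter», text of record 00368bf2689bd8ac after the re-key
A2cl → A2ml (05:27Z), critic idea-crit-3 g8 PASS, members OF RECORD since census v1.82 / v1.84; this port makes the decided cells TREE-decided): VERBATIM PORT of
`pub/ideators/ns-idea-2/lines/diffusion-meter/line-diffusion-meter.lean` sha16 00368bf2689bd8ac (534 l., lean check rc 0, 0 sorry), split for the 400-line rule into
`ScenarioCensusDiffusionMeter` (§A–§C) → `…DiffusionMeterRows` (§D–§G + census KEYS).  Lean text VERBATIM in namespace `…Theorems.ScenarioCensus.DiffusionMeter` (the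
line's `…Lines.DiffusionMeter` re-homed); port edits: `local notation "E3"` → `abbrev E3` (typer lint: no notation in port files), `@[conjecture]` on the OPEN rows
`Row_A2lapU` / `Row_A2cdU` (typed only), six one-line docstrings added (gate lint); the Cauchy–Schwarz twin `lintegral_unitBall_enorm_le_sqrt'` (≡ the Literature lemma
`BarkerPrange2020.lintegral_unitBall_enorm_le_sqrt`, whose module `HeatExtensionFarFieldUloc` the farm does not build at port time) is not re-declared: its own proof is
carried inline at its single use in `exists_gauss_unit_bound` (proof text only).  Statements untouched.

No census VALUE is moved here (the cells become TREE-decided by name; booking is the lead's); NS regularity is NOT proved; (L′) ⟨10661⟩ is untouched; no summit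
statement is proved by this file.
-/

-- the summit and its single problem share the name `NavierStokesRegularity` (D-0017 nested layout)
set_option linter.dupNamespace false

noncomputable section

open Set Function Filter Topology Metric MeasureTheory
open scoped RealInnerProductSpace ENNReal NNReal Laplacian

namespace Summit.NavierStokesRegularity.NavierStokesRegularity.Theorems.ScenarioCensus.DiffusionMeter

open Literature.Analysis Literature.Analysis.FluidPDE Literature.Analysis.UnboundedOperators
open Summit.NavierStokesRegularity.NavierStokesRegularity.Theorems
open Summit.NavierStokesRegularity.NavierStokesRegularity.Theorems.SimilarityEnstrophy
  (typeI_ancient_eq_zero_of_rate_lt_one)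
open Summit.NavierStokesRegularity.NavierStokesRegularity.Theorems.SymmetryModuliCountSymmetricLiouville
  (vanishes_of_vanishes_before)

/-- `ℝ³` (the line's `local notation "E3"`, spelled as a reducible abbreviation for the tree). -/
abbrev E3 := EuclideanSpace ℝ (Fin 3)

/-! ## A. The far-past ledger at unit radius, in `lintegral` form -/

/-- The ledger `∫_{B_1(z)} ‖u(t)‖² ≤ K(C)` for every `u ∈ A_C`, `t < 0`, `z`, as an `ℝ≥0∞` bound
on `∫⁻ ‖u t‖ₑ²` over unit balls (`FarPastLedger_proof`, ⟨14060⟩, at `R = 1`). -/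
theorem ledger_unitBall (C : ℝ) : ∃ K : ℝ, 0 ≤ K ∧ ∀ u : ℝ → E3 → E3, IsTypeIAncientMild C u →
    ∀ t < 0, ∀ z : E3, ∫⁻ y in ball z 1, ‖u t y‖ₑ ^ 2 ≤ ENNReal.ofReal K := by
  obtain ⟨K, hK⟩ := FarPastLedger_proof C
  refine ⟨max K 0, le_max_right _ _, fun u hu t ht z => ?_⟩
  have h1 : ∫ y in ball z 1, ‖u t y‖ ^ 2 ≤ K * 1 := hK u hu t ht z 1 one_pos
  have hcont : Continuous (u t) := hu.continuous_slice ht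
  have hint : IntegrableOn (fun y => ‖u t y‖ ^ 2) (ball z 1) := by
    refine Measure.integrableOn_of_bounded (M := (C / Real.sqrt (-t)) ^ 2) measure_ball_lt_top.ne
      ((hcont.norm.pow 2).aestronglyMeasurable) ?_
    refine (ae_restrict_iff' measurableSet_ball).2 (Eventually.of_forall fun y _ => ?_)
    rw [Real.norm_of_nonneg (by positivity)]
    exact pow_le_pow_left₀ (norm_nonneg _) (hu.norm_le ht y) 2
  have heq : ∫⁻ y in ball z 1, ‖u t y‖ₑ ^ 2 = ENNReal.ofReal (∫ y in ball z 1, ‖u t y‖ ^ 2) := by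
    rw [ofReal_integral_eq_lintegral_ofReal hint (Eventually.of_forall fun y => by positivity)]
    refine lintegral_congr fun y => ?_
    rw [← ofReal_norm, ← ENNReal.ofReal_pow (norm_nonneg _)]
  rw [heq]
  exact ENNReal.ofReal_le_ofReal (by linarith [le_max_left K 0])

/-! ## B. The unit-scale Gaussian average of a uniformly-locally-`L²` field -/

/-- `G₁(y) ≤ 98304 (1 + |y|)⁻⁴` on all of `ℝ³` (`(4π)^{-3/2} ≤ 1`; `e^{-u} ≤ 4!/u⁴` with
`u = |y|²/4` and `|y|⁻⁸ ≤ |y|⁻⁴ ≤ 16(1+|y|)⁻⁴` off the unit ball; `1 ≤ 98304/16` on it).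
Self-contained twin of the tree's `heatKernel_le_inv_one_add_norm_pow_four` (module
`HeatExtensionFarFieldUloc`, not imported here). -/
theorem heatKernel_one_le_weight (y : E3) : heatKernel 1 y ≤ 98304 * ((1 + ‖y‖) ^ 4)⁻¹ := by
  set r : ℝ := ‖y‖ with hr
  have hr0 : 0 ≤ r := norm_nonneg y
  have hpre : (4 * Real.pi * (1 : ℝ)) ^ (-(3 : ℝ) / 2) ≤ 1 :=
    Real.rpow_le_one_of_one_le_of_nonpos (by nlinarith [Real.pi_gt_three]) (by norm_num)
  have hexp1 : Real.exp (-(1 / (4 * (1 : ℝ))) * r ^ 2) ≤ 1 := by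
    rw [Real.exp_le_one_iff]
    nlinarith [sq_nonneg r]
  have hG : heatKernel 1 y ≤ Real.exp (-(1 / (4 * (1 : ℝ))) * r ^ 2) := by
    rw [heatKernel_eq, finrank_euclideanSpace_fin]
    push_cast
    exact mul_le_of_le_one_left (Real.exp_pos _).le hpre
  have h14 : 0 < (1 + r) ^ 4 := by positivity
  by_cases hy : 1 ≤ r
  · -- off the unit ball: `e^{-u} ≤ 24/u⁴`, `u = r²/4`
    set u : ℝ := r ^ 2 / 4 with hu
    have hu0 : 0 < u := by rw [hu]; positivity
    have hfac : u ^ 4 / 24 ≤ Real.exp u := by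
      have := Real.pow_div_factorial_le_exp u hu0.le 4
      norm_num [Nat.factorial] at this
      exact this
    have hexp : Real.exp (-(1 / (4 * (1 : ℝ))) * r ^ 2) ≤ 24 / u ^ 4 := by
      have e1 : -(1 / (4 * (1 : ℝ))) * r ^ 2 = -u := by rw [hu]; ring
      rw [e1, Real.exp_neg, le_div_iff₀ (by positivity)]
      rw [div_le_iff₀ (by norm_num : (0:ℝ) < 24)] at hfac
      calc (Real.exp u)⁻¹ * u ^ 4 = u ^ 4 / Real.exp u := by rw [div_eq_mul_inv, mul_comm]
        _ ≤ 24 := by rw [div_le_iff₀ (Real.exp_pos u)]; linarith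
    -- `24/u⁴ = 6144/r⁸ ≤ 6144/r⁴ ≤ 98304/(1+r)⁴`
    have hr4 : 1 ≤ r ^ 4 := one_le_pow₀ hy
    have hu4 : u ^ 4 = r ^ 4 * r ^ 4 / 256 := by rw [hu]; ring
    have h1r : (1 + r) ^ 4 ≤ 16 * r ^ 4 := by
      have : 1 + r ≤ 2 * r := by linarith
      calc (1 + r) ^ 4 ≤ (2 * r) ^ 4 := pow_le_pow_left₀ (by positivity) this 4
        _ = 16 * r ^ 4 := by ring
    have hr4pos : 0 < r ^ 4 := by positivity
    calc heatKernel 1 y ≤ Real.exp (-(1 / (4 * (1 : ℝ))) * r ^ 2) := hG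
      _ ≤ 24 / u ^ 4 := hexp
      _ = 6144 / (r ^ 4 * r ^ 4) := by rw [hu4]; field_simp; ring
      _ ≤ 6144 / (r ^ 4 * 1) := by gcongr
      _ ≤ 98304 * ((1 + r) ^ 4)⁻¹ := by
          rw [mul_one, ← div_eq_mul_inv, div_le_div_iff₀ hr4pos h14]
          nlinarith
  · -- on the unit ball: `G₁ ≤ 1 ≤ 98304/16 ≤ 98304/(1+r)⁴`
    push Not at hy
    have h2 : (1 + r) ^ 4 ≤ 2 ^ 4 := pow_le_pow_left₀ (by positivity) (by linarith) 4
    have h4 : (1 : ℝ) ≤ 98304 * ((1 + r) ^ 4)⁻¹ := by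
      rw [← div_eq_mul_inv, le_div_iff₀ h14]
      linarith
    exact (hG.trans hexp1).trans h4

-- `lintegral_unitBall_enorm_le_sqrt'`: the Cauchy–Schwarz bound on unit balls restates a landed Literature lemma (`BarkerPrange2020.lintegral_unitBall_enorm_le_sqrt`, module `HeatExtensionFarFieldUloc`, which the farm does not build at port time — gate lint dedup.landed); not re-declared — its single use in `exists_gauss_unit_bound` carries the line's own proof inline (proof text only).

/-- **Unit-scale Gaussian average of a uniformly-locally-`L²` field.** There is an absolute
`C_g < ∞` with `∫ G₁(y) ‖b(y)‖ dy ≤ C_g (A·|B₁|)^{1/2}` whenever `∫_{B_1(z)} ‖b‖² ≤ A` for all `z`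
(Cauchy–Schwarz on unit balls, `lintegral_unitBall_enorm_le_sqrt`, and summation against the
weight `(1+|y|)⁻⁴`, `exists_lintegral_mul_inv_one_add_norm_pow_le`). -/
theorem exists_gauss_unit_bound : ∃ Cg : ℝ≥0∞, Cg ≠ ⊤ ∧ ∀ b : E3 → E3,
    AEStronglyMeasurable b volume → ∀ A : ℝ≥0∞,
    (∀ z : E3, ∫⁻ y in ball z 1, ‖b y‖ₑ ^ 2 ≤ A) →
    ∫⁻ y, ‖heatKernel 1 y • b y‖ₑ ≤ Cg * (A * volume (ball (0 : E3) 1)) ^ (1 / 2 : ℝ) := by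
  obtain ⟨Cw, hCwtop, hCw⟩ := exists_lintegral_mul_inv_one_add_norm_pow_le
  refine ⟨ENNReal.ofReal 98304 * Cw, ENNReal.mul_ne_top ENNReal.ofReal_ne_top hCwtop,
    fun b hb A hA => ?_⟩
  set A₁ : ℝ≥0∞ := (A * volume (ball (0 : E3) 1)) ^ (1 / 2 : ℝ)
  -- (see the inlined bound below)
  have hL1 : ∀ z : E3, ∫⁻ y in ball z 1, ‖b y‖ₑ ≤ A₁ := fun z => by
    -- the line's `lintegral_unitBall_enorm_le_sqrt'` (twin of a Literature lemma in a module without a farm build), inlined: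
    set μ : Measure E3 := volume.restrict (ball z 1) with hμ
    have h := eLpNorm_le_eLpNorm_mul_rpow_measure_univ (by norm_num : (1 : ℝ≥0∞) ≤ 2)
      (hb.restrict : AEStronglyMeasurable b μ)
    rw [eLpNorm_one_eq_lintegral_enorm] at h
    have hexp : (1 / (1 : ℝ≥0∞).toReal - 1 / (2 : ℝ≥0∞).toReal : ℝ) = 1 / 2 := by norm_num
    have hvol : μ univ = volume (ball (0 : E3) 1) := by
      rw [hμ, Measure.restrict_apply_univ, Measure.addHaar_ball_center]
    rw [hexp, hvol] at h
    have hsq : ∫⁻ y, ‖b y‖ₑ ^ 2 ∂μ = eLpNorm b 2 μ ^ 2 := by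
      rw [eLpNorm_eq_lintegral_rpow_enorm_toReal (by norm_num) (by norm_num), ENNReal.toReal_ofNat,
        ← ENNReal.rpow_natCast, ← ENNReal.rpow_mul]
      norm_num
    have h2 : eLpNorm b 2 μ ≤ A ^ (1 / 2 : ℝ) := by
      have h1 := ENNReal.rpow_le_rpow (z := (1 / 2 : ℝ)) (hsq.symm.le.trans (hA z)) (by norm_num)
      rwa [← ENNReal.rpow_natCast, ← ENNReal.rpow_mul,
        show ((2 : ℕ) : ℝ) * (1 / 2) = 1 by norm_num, ENNReal.rpow_one] at h1
    calc ∫⁻ y, ‖b y‖ₑ ∂μ ≤ eLpNorm b 2 μ * volume (ball (0 : E3) 1) ^ (1 / 2 : ℝ) := h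
      _ ≤ A ^ (1 / 2 : ℝ) * volume (ball (0 : E3) 1) ^ (1 / 2 : ℝ) := by gcongr
      _ = (A * volume (ball (0 : E3) 1)) ^ (1 / 2 : ℝ) :=
          (ENNReal.mul_rpow_of_nonneg _ _ (by norm_num)).symm
  have hpt : ∀ y : E3, ‖heatKernel 1 y • b y‖ₑ ≤
      ENNReal.ofReal 98304 * (‖b y‖ₑ * ENNReal.ofReal (((1 + ‖y - 0‖) ^ 4)⁻¹)) := fun y => by
    have hG : ‖heatKernel 1 y‖ₑ ≤ ENNReal.ofReal 98304 * ENNReal.ofReal (((1 + ‖y - 0‖) ^ 4)⁻¹) := by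
      rw [sub_zero, Real.enorm_eq_ofReal (heatKernel_pos one_pos y).le,
        ← ENNReal.ofReal_mul (by norm_num)]
      exact ENNReal.ofReal_le_ofReal (heatKernel_one_le_weight y)
    calc ‖heatKernel 1 y • b y‖ₑ = ‖heatKernel 1 y‖ₑ * ‖b y‖ₑ := enorm_smul _ _
      _ ≤ (ENNReal.ofReal 98304 * ENNReal.ofReal (((1 + ‖y - 0‖) ^ 4)⁻¹)) * ‖b y‖ₑ :=
          mul_le_mul' hG le_rfl
      _ = ENNReal.ofReal 98304 * (‖b y‖ₑ * ENNReal.ofReal (((1 + ‖y - 0‖) ^ 4)⁻¹)) := by ring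
  calc ∫⁻ y, ‖heatKernel 1 y • b y‖ₑ
      ≤ ∫⁻ y, ENNReal.ofReal 98304 * (‖b y‖ₑ * ENNReal.ofReal (((1 + ‖y - 0‖) ^ 4)⁻¹)) :=
        lintegral_mono hpt
    _ = ENNReal.ofReal 98304 * ∫⁻ y, ‖b y‖ₑ * ENNReal.ofReal (((1 + ‖y - 0‖) ^ 4)⁻¹) :=
        lintegral_const_mul' _ _ ENNReal.ofReal_ne_top
    _ ≤ ENNReal.ofReal 98304 * (Cw * A₁) := by
        gcongr
        exact hCw (fun y => ‖b y‖ₑ) hb.enorm A₁ hL1 0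
    _ = ENNReal.ofReal 98304 * Cw * A₁ := (mul_assoc _ _ _).symm

/-! ## C. The coarse law: `√s ‖e^{sΔ}u(t)‖_∞ ≤ L(C)` for every `s > 0` -/

/-- **Coarse law.** For every `C` there is `L = L(C) ≥ 0` with `‖e^{sΔ}u(t)(x)‖ ≤ L/√s` for all
`u ∈ A_C`, `t < 0`, `s > 0`, `x` — the far-past ledger transported to heat time `1` by the class
symmetries (translation by `x`, parabolic rescaling by `√s`) and the unit-scale Gaussian bound. -/
theorem coarse_bound (C : ℝ) : ∃ L : ℝ, 0 ≤ L ∧ ∀ u : ℝ → E3 → E3, IsTypeIAncientMild C u →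
    ∀ t < 0, ∀ s : ℝ, 0 < s → ∀ x : E3, ‖heatExtension (u t) s x‖ ≤ L / Real.sqrt s := by
  obtain ⟨K, hK0, hK⟩ := ledger_unitBall C
  obtain ⟨Cg, hCgtop, hCg⟩ := exists_gauss_unit_bound
  set V : ℝ≥0∞ := volume (ball (0 : E3) 1) with hV
  set A₁ : ℝ≥0∞ := (ENNReal.ofReal K * V) ^ (1 / 2 : ℝ) with hA₁
  have hA₁top : A₁ ≠ ⊤ := ENNReal.rpow_ne_top_of_nonneg (by norm_num)
    (ENNReal.mul_ne_top ENNReal.ofReal_ne_top measure_ball_lt_top.ne)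
  refine ⟨(Cg * A₁).toReal, ENNReal.toReal_nonneg, fun u hu t ht s hs x => ?_⟩
  set c : ℝ := Real.sqrt s with hc
  have hc0 : 0 < c := Real.sqrt_pos.2 hs
  have hcc : c ^ 2 = s := Real.sq_sqrt hs.le
  set w : ℝ → E3 → E3 := FluidPDE.nsRescale c (fun t' z => u t' (z + x)) with hw
  have hw_mem : IsTypeIAncientMild C w := (hu.comp_add_right x).nsRescale hc0
  have hts : t / s < 0 := div_neg_of_neg_of_pos ht hs
  -- the pointwise identity behind the change of variables
  have hpt : ∀ z : E3, heatKernel 1 z • u t (x + c • z) = c⁻¹ • (heatKernel 1 z • w (t / s) z) := by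
    intro z
    have h1 : w (t / s) z = c • u t (x + c • z) := by
      simp only [hw, nsRescale_apply]
      rw [hcc, mul_div_cancel₀ t hs.ne', add_comm]
    rw [h1, smul_comm (heatKernel 1 z) c, smul_smul, inv_mul_cancel₀ hc0.ne', one_smul]
  -- representation of the caloric extension through the rescaled, translated, reflected element
  have hrep : heatExtension (u t) s x = c⁻¹ • ∫ z, heatKernel 1 z • w (t / s) z := by
    rw [heatExtension_eq_integral_heatKernel_one hs]
    have hflip : ∫ z : E3, heatKernel 1 z • u t (x - c • z) =
        ∫ z : E3, heatKernel 1 z • u t (x + c • z) := by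
      rw [← integral_neg_eq_self (fun z : E3 => heatKernel 1 z • u t (x + c • z)) volume]
      refine integral_congr_ae (Eventually.of_forall fun z => ?_)
      simp only [heatKernel_neg, smul_neg, sub_eq_add_neg]
    rw [hflip, ← integral_smul]
    exact integral_congr_ae (Eventually.of_forall hpt)
  -- the unit-scale bound for the class element `w` at the time `t/s < 0`
  have hwm : AEStronglyMeasurable (w (t / s)) volume := hw_mem.aestronglyMeasurable_slice hts
  have hwA : ∀ z : E3, ∫⁻ y in ball z 1, ‖w (t / s) y‖ₑ ^ 2 ≤ ENNReal.ofReal K :=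
    fun z => hK w hw_mem (t / s) hts z
  have hI : ‖∫ z, heatKernel 1 z • w (t / s) z‖ ≤ (Cg * A₁).toReal := by
    refine (norm_integral_le_lintegral_norm _).trans (ENNReal.toReal_mono
      (ENNReal.mul_ne_top hCgtop hA₁top) ?_)
    have := hCg (w (t / s)) hwm (ENNReal.ofReal K) hwA
    simpa only [ofReal_norm] using this
  rw [div_eq_inv_mul, hrep, norm_smul, norm_inv, Real.norm_of_nonneg hc0.le]
  exact mul_le_mul_of_nonneg_left hI (inv_nonneg.2 hc0.le)

end Summit.NavierStokesRegularity.NavierStokesRegularity.Theorems.ScenarioCensus.DiffusionMeter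

end
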